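import Literature.NumberTheory.ComplexMultiplication.CMBalancedDivisorOfPolarisedStructure
import Literature.AlgebraicGeometry.Motives.AbelianVarietyHomRationalCommonFieldPair
import HarnessLib

/-!
# Row II-1-S5b IS row II-1-S5b″: `exists_balancedDivisor_finiteExtension` from `exists_balancedPolarisedStructure_numberField`
# (Shimura 1998 §6.2 Thm. 4 (3), §12.4 Prop. 26, §4.1 Prop. 10, §7.4 Prop. 15, §1.2) — the h21 junction `FactS5b_of_S5b″`

Topic `Literature/NumberTheory/ComplexMultiplication`, namespace `Literature.NumberTheory.ComplexMultiplication`.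
THEOREMS ONLY (no definition, no instance, no named fact; net Literature debt **−1**: the named fact
`exists_balancedDivisor_finiteExtension` (row II-1-S5b) becomes a theorem of the named fact
`exists_balancedPolarisedStructure_numberField` (row II-1-S5b″); cell `hodgecm-mathlib` (D-0151), h21 line
`b2-main-theorem-cm` (`stub_balancedDivisor := exists_balancedDivisor_finiteExtension_of_balancedPolarisedStructure
stub_S5b″`), director ruling «S5b OPTION R» 2026-08-28T06:10:16Z).

The proof is the assembly of three tree theorems: the common finite extension `L′ ⊂ ℂ` of `L` and `k` over which the
homomorphisms of the pair `(A₀ ⊗ L′, B₀ ⊗ L′)` are rational in both directions ([Shimura1998] §1.2 / §18.6 (iv) — A-p04's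
`AbelianVariety.exists_intermediateField_surjective_homBaseChange_pair`, from row II-1-S9 `homDefinedOverFiniteExtension_holds`),
and the transport `exists_balancedDivisor_of_polarisedModel` (`CMBalancedDivisorOfPolarisedStructure`: `𝔬_K`-linear isogeny
over `L′` by §7.4 Prop. 15, divisor `λ^*(pr^*Θ₀)`, Rosati-balancedness and radical bound by Mumford §20 (3) / Lang VII §2
Prop. 4).

## References
* [Shimura1998] G. Shimura, *Abelian Varieties with Complex Multiplication and Modular Functions* (1998): §1.2 (p. 4),
  §4.1 Prop. 10 (p. 23), §6.2 Thm. 4 (3) (p. 44), §7.4 Prop. 15 (p. 53), §12.4 Prop. 26, §18.4 (18.4b) (≈ p. 123), §18.6 proof of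
  Thm. 18.6, condition (iv) on L (p. 127).
* [MumfordAV1970] D. Mumford, *Abelian Varieties* (1970), §20 (3) (p. 186), §23 (p. 208).
* [Lang1983AbelianVarieties] S. Lang, *Abelian Varieties*, Ch. VII §2 Prop. 4.
-/

set_option autoImplicit false

noncomputable section

open CategoryTheory CategoryTheory.Limits NumberField AlgebraicGeometry

namespace Literature.NumberTheory.ComplexMultiplication

open Literature.AlgebraicGeometry.Motives Literature.AlgebraicGeometry.Motives.AbelianVariety

/-- **Row II-1-S5b from row II-1-S5b″ (`FactS5b_of_S5b″`)**: the `K`-balanced non-degenerate divisor over a finite extension of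
the field of definition of ANY structure `(A₀, ι₀)` of type `(K, Φ)` over a number field `L ⊂ ℂ` — [Shimura1998] §6.2
Thm. 4 (3) with §4.1 Prop. 10, AS TYPED in `exists_balancedDivisor_finiteExtension` — follows from the existence of ONE
polarised structure `(B₀, ι_B, Θ₀)` of type `(K, Φ)` over a number field with Rosati-balanced ample `Θ₀` (§6.2 Thm. 4 (3) +
§12.4 Prop. 26 + §4.1 Prop. 10, the named fact `exists_balancedPolarisedStructure_numberField`): over a common finite
`L′ ⊂ ℂ` over which the homomorphisms between `A₀ ⊗ L′` and `B₀ ⊗ L′` are rational (§1.2,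
`exists_intermediateField_surjective_homBaseChange_pair`) pull `Θ₀` back along the `𝔬_K`-linear isogeny
`λ : A₀ ⊗ L′ → B₀ ⊗ L′` of §7.4 Prop. 15 (`exists_balancedDivisor_of_polarisedModel`).
[cite: Shimura1998, §6.2 Thm. 4 (3) p. 44; §4.1 Prop. 10 p. 23; §12.4 Prop. 26; §7.4 Prop. 15 p. 53; §1.2 p. 4; §18.6 proof of Thm. 18.6, condition (iv) on L, p. 127]
[cite: MumfordAV1970, §20 (3) (p. 186), §23 (p. 208)] [cite: Lang1983AbelianVarieties, Ch. VII §2 Prop. 4] -/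
theorem exists_balancedDivisor_finiteExtension_of_balancedPolarisedStructure
    (h : exists_balancedPolarisedStructure_numberField) : exists_balancedDivisor_finiteExtension := by
  intro K _ _ _ Φ L _ _ _ A₀ ι₀ hA₀
  obtain ⟨k, _, _, _, B₀, ιB, hB₀, Θ₀, hΘ₀, hbal₀⟩ := h K Φ
  obtain ⟨L', hfd, _, _, hAB, hBA⟩ := exists_intermediateField_surjective_homBaseChange_pair A₀ B₀
  obtain ⟨X, hX⟩ := exists_balancedDivisor_of_polarisedModel hA₀ hB₀ Θ₀ hΘ₀ hbal₀ L' hAB hBA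
  exact ⟨L', hfd, X, hX⟩

/-- **The two rows are one citation**: `S5b″ → S5b` as an implication between the named `Prop`s (the shape the h21
workfile's `stub_balancedDivisor` consumes). [cite: Shimura1998, §6.2 Thm. 4 (3) p. 44; §4.1 Prop. 10 p. 23] -/
theorem exists_balancedPolarisedStructure_numberField_imp_balancedDivisor :
    exists_balancedPolarisedStructure_numberField → exists_balancedDivisor_finiteExtension :=
  exists_balancedDivisor_finiteExtension_of_balancedPolarisedStructure

end Literature.NumberTheory.ComplexMultiplication

end
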